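import Literature.MathematicalPhysics.QuantumFieldTheory.Balaban1983to89.B9SectBCodedChainR6
import Literature.MathematicalPhysics.QuantumFieldTheory.Balaban1983to89.B9SectBCodedReadingsUParH
import Literature.MathematicalPhysics.QuantumFieldTheory.Balaban1983to89.B9SectBFrameGpSwap

/-!
# `Balaban1983to89.B9SectBCodedFamiliesUParH` — T. Bałaban, *Propagators for lattice gauge theories in a background field*, Commun. Math. Phys. **99** (1985) 389–434
# [Balaban1985BackgroundPropagators], Thm 3.4 p. 400 ∕ Sect. B pp. 400–407 with (3.21) p. 394 and (3.40) p. 397: THE FRAME FAMILY `KSC₇Par parA parH` OF THE TWO-TRANSPORTER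
# CODED READING `KSCUPar`, ITS DICTIONARIES, THE INPUT TRANSPORT `hin_KSCUPar_on_pos`, AND THE TRANSPORTER-BLIND MEMBERS (3.42) ∕ (3.44) ∕ (3.47) ∕ (3.48) ∕
# ANALYTICITY OF THE SECT.-B STEP FOR `KSCUPar` (pub-ymgap N06 [B9]; CASCADE-K step K1, the (C) road, module F1)

statement-level skeleton of published theorems with citation tags; proofs where landed; nothing here is a claim about the Yang–Mills mass gap

THE PRINT.  Sect. B (pp. 400–407) derives (3.42)–(3.48) for `G′(U′U)` from the same at `U`; (3.21) p. 394 fixes the AVERAGING contours `Γ_{y,x}` inside `Q′(U)`,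
(3.40) p. 397 the SHORTEST contours `Γ_{x,x′}` of the Hölder quotients in (3.43), (3.45).  Two contour families, one step.

WHY THIS FILE (pub-ymgap node N06 [B9]; director-ym №383 CASCADE-K, K1 := this seat's lineage; node00-def-Y's ruling on ⚑ FLAG K1-PAR: the coded site-sector
reading with the two printed transporter roles separated is `B9SectBCodedReadingsUParH.KSCUPar P G x parA parH := kernelFamilySU … (GpY parA) parH`).  The tree's
Sect.-B members for the single-transporter reading `KSCU par` are each a FRAME STEP for an augmented family (`KSC ∕ KSC₅ ∕ KSC₆ ∕ KSC₇ ∕ KSC₃ par`) followed by an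
INPUT TRANSPORT `hin` (`block(KSCU par) ⟹ block(frame family)`) and an OUTPUT TRANSPORT `hout`.  For `KSCUPar parA parH` the input transport into `KSC parA`'s
family is NOT available (the Hölder members (3.43)∕(3.45) of `KSC parA` at a base read the transporter `parA`, those of `KSCUPar` read `parH`), so the frame family
must carry `KSCUPar`'s Hölder members.  THIS FILE:
* §1 ★★ `KSC₇Par P G x parA parH := { KSC parA with h1, e4, h2 := (KSCUPar parA parH).… }` — the two-transporter twin of `B9SectBH2FrameCodedY.KSC₇`
  (`KSC₇_eq_KSC₇Par : KSC₇ par = KSC₇Par par par`, `rfl`); its members (`rfl`), block bridges (`eBlock ∕ h1Block ∕ e4Block ∕ h2Block ∕ l2Block ∕ globBlock_KSC₇Par_iff`),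
  the (3.42) dictionaries `read342Y_KSC₇Par ∕ write342Y_KSC₇Par` (= `KSC parA`'s).  (The base identities `KSCUPar_members_base` ∕ `thms_KSCUPar_base_iff` of the
  READING `KSCUPar` are dag-n06-d's, module `B9LeafXCodedKnitUParH` — not declared here; this file reads the base block of `KSCUPar` through `KSCUPar_blind_members`
  and `B9SectBStepsKSCU.KSCU_members_base`.)
* §2 ★★ `thms_KSC₇Par_base_of_KSCUPar` — at a `G`-valued base the Theorem-3.1–3.3 block of `(KSCUPar, KACU, C)` gives that of `(KSC₇Par, KACU, C)` with
  `B₀ ↦ c_in(δ₀)·max B₀ 0`: the (3.42) entries by `B9SectBGpTransferInY.eBlock_KSC_base` AT `parA` (the record reading's (3.42)∕(3.46)∕(3.47) members do not read the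
  transporter), the Hölder block BY IDENTITY at `parH`; ★★ `hin_KSCUPar_on_pos` — the input transport with positive constants (shape of `B9SectBStepsKSCU.hin_KSCU_on_pos`).
* §3 the output transports for `KSCUPar`: `houtE_KSCUPar_on` ((3.42), `B9SectBStepsKSCUBlocks.eBlock_KSCU_of_KSC` at `parA`), `houtEGlob_KSCUPar_on` ((3.47)).
* §4 THE TRANSPORTER-BLIND MEMBERS OF THE SECT.-B STEP OF RECORD FOR `(KSCUPar, KACU, C⁻¹(parA))`: ★ `stepEPos_KSCUPar_on` (root frame `gpFrame₂CodedOn` AT `KSC₇Par`),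
  ★ `stepGlobPos_KSCUPar_on`, ★ `stepE4Pos_KSCUPar_on` (`e4Frame₃CodedOn parA` re-keyed to `KSC₇Par` by `E4Frame₃.swapGp`), ★ `stepKerPos_KSCUPar_on`
  (`cinvFrame₃CodedOn parA` re-keyed by `CinvFrame₃.swapGp`; displays `hunitX`, `hsym` AT `parA`), ★ `stepAnalyticPos_KSCUPar_on` (`anFrame₂CodedOn` AT `KSC₇Par`, pin
  `IsAnKY parA`).  Binders = those of the single-transporter theorems with `par ↦ parA`; NO law of `parH` enters these five members.
The Hölder members (3.43)∕(3.45) (`stepH1Pos ∕ stepH2Pos_KSCUPar_on`, which DO read `parH`), the (3.46) member, the G-side members and the assembly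
`sectBStepUPar_of_members` are the successor modules F2–F5 of this road.

HONEST SCOPE ∕ NOT CLAIMED.  Bookkeeping over landed frames: one `def` (the family `KSC₇Par`), `rfl` identities, one 40-line transport estimate assembled from landed
lemmas, and five transported step theorems; nothing of [B9]'s analysis is re-proved; every displayed law (`hpar hunit hunitX hsym hC37` at `parA`) is a hypothesis;
count-neutral; N06 NOT discharged; nothing continuum ∕ OS ∕ mass gap ∕ Clay.  NEW file; no `sorry`, no `axiom`, no `instance`, no `notation`.  Cell `pub-ymgap`
(D-0062), seat `pub-ymgap-dag-n06-c` (gen 24), 2026-08-30; `--supports stmt-QuantumFields-27364`.  Net new unproved facts: 0.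

RELATED IN THE TREE, NOT DUPLICATED (searched 2026-08-30: `rg 'KSC₇Par|KSCUPar_on|hin_KSCUPar' lean/Literature lean/Summits` — 0 hits): `B9SectBCodedReadingsUParH`
(`KSCUPar`, USED), `B9SectBH2FrameCodedY(R)` (`KSC₇` = the diagonal instance), `B9SectBStepsKSCU(R) ∕ B9SectBStepsKSCUBlocks(R) ∕ B9SectBE4FrameCodedY(R) ∕
B9SectBKerFrameCodedY(R) ∕ B9SectBEGlobAnStepRecordOn(R)` (the single-transporter members and their transports, USED as lemmas), `B9SectBFrameGpSwap` (USED).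
-/

noncomputable section

namespace Literature.MathematicalPhysics.QuantumFieldTheory.Balaban1983to89.B9SectBCodedFamiliesUParH

open Literature.MathematicalPhysics.QuantumFieldTheory.Balaban1983to89.B9SectBCodedClassR (RegExtraY bg9YC)
open B6RandomWalk (HasMajorant hasMajorant_mono BlockSupp)
open B6KLevelCensusIndexV1 (KIdx kGeo)
open B6Ineq2142KLevelV1 (β)
open B9Thm34Ext (toB6)
open B9FromB6 (EBlock H1Block E4Block H2Block L2Block GlobBlock)
open B9SectBCodedCarrier (CCfg Coding pullK pullS)
open B9Eq360DeltaPrimeAY (AfldY)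
open B9PinMembersKLevelV1 (MemberY geo9Y bg9Y)
open B9SectBGpLettersY (GVal decY)
open B9SectBGpFrameCodedYR (codingYx Read342Y Write342Y)
open B9SectBGpFrameCodedY (CplxLettersY)
open B9SectBGpReadingsYR (KSC read342Y_KSC write342Y_KSC)
open B9SectBGpReadingsY (baseY)
open B9SectBCodedReadingsUR (KSCU KACU)
open B9SectBCodedReadingsUParH (KSCUPar)
open B9SectBStepsKSCUR (KACU_members_base ineq342_346_347_congr)
open B9SectBStepsKSCUBlocksR (eBlock_KSCU_of_KSC globBlock_KSCU_of_eBlock_KSC)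
open B9SectBGpTransferInYR (ineq343_345_congr ineq342_346_347_mono eBlock_KSC_base KSC_members_base pullK_members_base)
open B9SectBCodedChainOnSubfamilyR (gpFrame₂CodedOn)
open B9SectBEGlobAnStepRecordOnR (stepEPos_KSC_on)
open B9SectBCodedChainAnR (IsAnKY anFrame₂CodedOn)
open B9SectBCodedChainL2R (thms_mono_B₀)
open B9SectBStepPosFamilyTransfer (stepPos_of_family_pos stepEPos_of_family_pos stepPos_blk_of_family_pos stepE4Pos_of_family_pos stepKerPos_of_family_pos)
open B9SectBStepWhole (StepEPos StepGlobPos StepE4Pos StepKerPos StepAnalyticPos1 StepAnalyticPos stepAnalyticPos_of_halves)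
open B9SectBGpStepAtLettersV2 (stepEPos_of_gpFrame₂ stepAnalyticPos1_of_anFrame₂)
open B9SectBKerFrameV3 (stepKerPos_of_cinvFrame₃)
open B9SectBKerFrameCodedYR (CinvY cinvFrame₃CodedOn)
open B9SectBE4FrameCodedY (stepE4Pos_of_e4Frame₃)
open B9SectBE4FrameCodedYR (KSC₆ eBlock_KSC₆_iff e4Block_KSC₆_iff e4Frame₃CodedOn)
open B9SectBH1FrameCodedYR (KSC₅)
open B9SectBH2FrameCodedYR (KSC₇)
open B9SectBH1ReadWriteY (h1ReadT)
open B9GeoNbrCountKLevelV1 (exists_card_nbr_geo9Y_le_of_M)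
open B9RWSumsReadsNbr (nbr)
open B9GeoNormsKLevelV1 (geo9K_wNorm_nonneg)
open Node00 (SiteY BlkY IBondY CfgY BallY SiteParY BondParY BondOpY liftY deltaPrimeAY kernelFamilyS kernelFamilyB GpY XY cdS cdsS hqS)

variable {d ℓ : ℕ} {hd : 1 ≤ d + 1} {hL : Odd (ℓ + 1) ∧ 1 < ℓ + 1} {b₀ b₁ : ℝ} {Mstar : ℕ}
variable {𝔸 : Type} [NormedRing 𝔸] (P : RegExtraY d ℓ hd hL b₀ b₁ Mstar 𝔸) [NormedAlgebra ℂ 𝔸] [CompleteSpace 𝔸]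

/-! ## §1 The family `KSC₇Par parA parH` and its dictionaries -/

section Family

variable (G : Subgroup 𝔸ˣ) (x : MemberY d ℓ hd hL b₀ b₁ Mstar) (parA parH par : SiteParY 𝔸 x.toKIdx) (OA : BondOpY 𝔸 x.toKIdx) (parB : BondParY 𝔸 x.toKIdx)
  {ι : Type} [Fintype ι] (b : Module.Basis ι ℝ 𝔸)
  (ιB : BlkY x.toKIdx → IBondY x.toKIdx) (C37 C38 : ℝ → CfgY 𝔸 x.toKIdx → AfldY 𝔸 x.toKIdx → Prop)

/-- ★★ **`KSC₇Par`** — the FRAME FAMILY of the two-transporter reading: g7's augmented coded reading `KSC parA` of `G′ = GpY parA` (the (3.42)∕(3.46)∕(3.47) members, read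
with the AVERAGING transporter's operator) with the (3.43), (3.44), (3.45) members REPLACED by those of `KSCUPar parA parH` (Hölder quotients transported by `parH`,
print's (3.40) shortest contours).  The two-transporter twin of `KSC₇`. [cite: Balaban1985BackgroundPropagators, (3.42)–(3.47) pp.397–398, Thm 3.4 p.400, (3.21) p.394, (3.40) p.397, p.403 l.2–7] -/
def KSC₇Par : B9.KernelFamily (geo9Y x) (codingYx P G x C37 C38).bg :=
  { KSC P G x parA C37 C38 with
    h1 := (KSCUPar P G x parA parH C37 C38).h1, e4 := (KSCUPar P G x parA parH C37 C38).e4, h2 := (KSCUPar P G x parA parH C37 C38).h2 }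

/-- `KSC₇` IS the diagonal instance: `KSC₇ par = KSC₇Par par par` (`rfl`). [cite: Balaban1985BackgroundPropagators, Thm 3.4 p.400, bookkeeping] -/
theorem KSC₇_eq_KSC₇Par : KSC₇ P G x par C37 C38 = KSC₇Par P G x par par C37 C38 := rfl

/-- the members of `KSC₇Par` (`rfl` ×6): (3.42)∕(3.46)∕(3.47) = `KSC parA`'s, (3.43)∕(3.44)∕(3.45) = `KSCUPar parA parH`'s. [cite: Balaban1985BackgroundPropagators, (3.42)–(3.47) pp.397–398, bookkeeping] -/
theorem KSC₇Par_members :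
    (KSC₇Par P G x parA parH C37 C38).e = (KSC P G x parA C37 C38).e ∧ (KSC₇Par P G x parA parH C37 C38).h1 = (KSCUPar P G x parA parH C37 C38).h1 ∧
      (KSC₇Par P G x parA parH C37 C38).e4 = (KSCUPar P G x parA parH C37 C38).e4 ∧ (KSC₇Par P G x parA parH C37 C38).h2 = (KSCUPar P G x parA parH C37 C38).h2 ∧
      (KSC₇Par P G x parA parH C37 C38).l2 = (KSC P G x parA C37 C38).l2 ∧ (KSC₇Par P G x parA parH C37 C38).glob = (KSC P G x parA C37 C38).glob :=
  ⟨rfl, rfl, rfl, rfl, rfl, rfl⟩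

/-- the (3.42)∕(3.44)∕(3.46)∕(3.47) members of `KSCUPar parA parH` do not read the Hölder transporter: they ARE `KSCU parA`'s (`rfl` ×4).
[cite: Balaban1985BackgroundPropagators, (3.42), (3.44), (3.46), (3.47) pp.397–398, bookkeeping] -/
theorem KSCUPar_blind_members :
    (KSCUPar P G x parA parH C37 C38).e = (KSCU P G x parA C37 C38).e ∧ (KSCUPar P G x parA parH C37 C38).e4 = (KSCU P G x parA C37 C38).e4 ∧
      (KSCUPar P G x parA parH C37 C38).l2 = (KSCU P G x parA C37 C38).l2 ∧ (KSCUPar P G x parA parH C37 C38).glob = (KSCU P G x parA C37 C38).glob :=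
  ⟨rfl, rfl, rfl, rfl⟩

/-- the (3.43) member of `KSC₇Par` on site arguments: the U-letter reading `h1ReadT (G′_{parA}(dec c)) (parH (base c)) (base c)` (`rfl`).
[cite: Balaban1985BackgroundPropagators, (3.43) p.398, (3.40) p.397, p.403 l.4–7, bookkeeping] -/
theorem KSC₇Par_h1_inl (c : (codingYx P G x C37 C38).bg.Cfg) (f : SiteY x.toKIdx → ℝ) (α : ℝ) (z : SiteY x.toKIdx → ℝ) :
    (KSC₇Par P G x parA parH C37 C38).h1 c (.inl f) α (.inl z) =
      h1ReadT x.toKIdx (GpY x.toKIdx parA (decY x.toKIdx c)) (parH (baseY x.toKIdx c)) (baseY x.toKIdx c) f α z := rfl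

/-- the (3.43) member of `KSC₇Par` vanishes off the (site argument, site cut-off) sector. [cite: Balaban1985BackgroundPropagators, (3.43) p.398, bookkeeping] -/
theorem KSC₇Par_h1_off (c : (codingYx P G x C37 C38).bg.Cfg) (α : ℝ) :
    (∀ (f : SiteY x.toKIdx → ℝ) (zb : Node00.FBondY x.toKIdx → ℝ), (KSC₇Par P G x parA parH C37 C38).h1 c (.inl f) α (.inr zb) = 0) ∧
    (∀ (J : Node00.FBondY x.toKIdx → ℝ) (ζ : (geo9Y x).Cut), (KSC₇Par P G x parA parH C37 C38).h1 c (.inr J) α ζ = 0) := by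
  refine ⟨fun f zb => rfl, fun J ζ => ?_⟩
  rcases ζ with z | z <;> rfl

/-- the (3.45) member of `KSC₇Par` on (site argument, site cut-off): `sup_E sup_{μ,ν} hqS (parH U) α (ζ·∇_{U,μ}G′_{parA}(dec c)∇*_{U,ν}(f ⊗ E))`, `U = base c` (`rfl`).
[cite: Balaban1985BackgroundPropagators, (3.45) p.398, (3.40) p.397, p.403 l.2–7, bookkeeping] -/
theorem KSC₇Par_h2_inl (c : (codingYx P G x C37 C38).bg.Cfg) (f : SiteY x.toKIdx → ℝ) (α : ℝ) (z : SiteY x.toKIdx → ℝ) :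
    (KSC₇Par P G x parA parH C37 C38).h2 c (.inl f) α (.inl z) =
      ⨆ E : BallY 𝔸, ⨆ μ : Fin (d + 1), ⨆ ν : Fin (d + 1), hqS x.toKIdx (parH (baseY x.toKIdx c)) α
        (fun w => ((z w : ℝ) : ℂ) • cdS x.toKIdx (baseY x.toKIdx c) μ
          (GpY x.toKIdx parA (decY x.toKIdx c) (cdsS x.toKIdx (baseY x.toKIdx c) ν (liftY f (E : 𝔸)))) w) := rfl

/-- the (3.45) member of `KSC₇Par` vanishes off the (site argument, site cut-off) sector. [cite: Balaban1985BackgroundPropagators, (3.45) p.398, bookkeeping] -/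
theorem KSC₇Par_h2_off (c : (codingYx P G x C37 C38).bg.Cfg) (α : ℝ) :
    (∀ (f : SiteY x.toKIdx → ℝ) (zb : Node00.FBondY x.toKIdx → ℝ), (KSC₇Par P G x parA parH C37 C38).h2 c (.inl f) α (.inr zb) = 0) ∧
    (∀ (J : Node00.FBondY x.toKIdx → ℝ) (ζ : (geo9Y x).Cut), (KSC₇Par P G x parA parH C37 C38).h2 c (.inr J) α ζ = 0) := by
  refine ⟨fun f zb => rfl, fun J ζ => ?_⟩
  rcases ζ with z | z <;> rfl

/-- the (3.42) block of `KSC₇Par` IS that of `KSC parA`. [cite: Balaban1985BackgroundPropagators, (3.42) p.397, bookkeeping] -/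
theorem eBlock_KSC₇Par_iff {B₀ δ : ℝ} (c : (codingYx P G x C37 C38).bg.Cfg) :
    EBlock (KSC₇Par P G x parA parH C37 C38) B₀ δ c ↔ EBlock (KSC P G x parA C37 C38) B₀ δ c := by
  rw [EBlock, EBlock, (KSC₇Par_members P G x parA parH C37 C38).1]

/-- the (3.46) block of `KSC₇Par` IS that of `KSC parA`. [cite: Balaban1985BackgroundPropagators, (3.46) p.398, bookkeeping] -/
theorem l2Block_KSC₇Par_iff {B₀ δ : ℝ} (c : (codingYx P G x C37 C38).bg.Cfg) :
    L2Block (KSC₇Par P G x parA parH C37 C38) B₀ δ c ↔ L2Block (KSC P G x parA C37 C38) B₀ δ c := by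
  rw [L2Block, L2Block, (KSC₇Par_members P G x parA parH C37 C38).2.2.2.2.1]

/-- the (3.43) block of `KSC₇Par` IS that of `KSCUPar`. [cite: Balaban1985BackgroundPropagators, (3.43) p.398, bookkeeping] -/
theorem h1Block_KSC₇Par_iff {Bβ : ℝ → ℝ} {δ : ℝ} (c : (codingYx P G x C37 C38).bg.Cfg) :
    H1Block (KSC₇Par P G x parA parH C37 C38) Bβ δ c ↔ H1Block (KSCUPar P G x parA parH C37 C38) Bβ δ c := by
  rw [H1Block, H1Block, (KSC₇Par_members P G x parA parH C37 C38).2.1]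

/-- the (3.44) block of `KSC₇Par` IS that of `KSCUPar` (and of `KSCU parA`, `KSC₆ parA`). [cite: Balaban1985BackgroundPropagators, (3.44) p.398, bookkeeping] -/
theorem e4Block_KSC₇Par_iff {Bε : ℝ → ℝ} {δ : ℝ} (c : (codingYx P G x C37 C38).bg.Cfg) :
    E4Block (KSC₇Par P G x parA parH C37 C38) Bε δ c ↔ E4Block (KSCUPar P G x parA parH C37 C38) Bε δ c := by
  rw [E4Block, E4Block, (KSC₇Par_members P G x parA parH C37 C38).2.2.1]

/-- the (3.44) block of `KSC₇Par` IS that of `KSC₆ parA` (both are `KSCU parA`'s: the (3.44) member does not read the transporter).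
[cite: Balaban1985BackgroundPropagators, (3.44) p.398, bookkeeping] -/
theorem e4Block_KSC₇Par_iff_KSC₆ {Bε : ℝ → ℝ} {δ : ℝ} (c : (codingYx P G x C37 C38).bg.Cfg) :
    E4Block (KSC₇Par P G x parA parH C37 C38) Bε δ c ↔ E4Block (KSC₆ P G x parA C37 C38) Bε δ c := by
  rw [e4Block_KSC₇Par_iff, e4Block_KSC₆_iff, E4Block, E4Block, (KSCUPar_blind_members P G x parA parH C37 C38).2.1]

/-- the (3.45) block of `KSC₇Par` IS that of `KSCUPar`. [cite: Balaban1985BackgroundPropagators, (3.45) p.398, bookkeeping] -/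
theorem h2Block_KSC₇Par_iff {Bεβ : ℝ → ℝ → ℝ} {δ : ℝ} (c : (codingYx P G x C37 C38).bg.Cfg) :
    H2Block (KSC₇Par P G x parA parH C37 C38) Bεβ δ c ↔ H2Block (KSCUPar P G x parA parH C37 C38) Bεβ δ c := by
  rw [H2Block, H2Block, (KSC₇Par_members P G x parA parH C37 C38).2.2.2.1]

/-- the (3.42) block of `KSCUPar` IS that of `KSCU parA`. [cite: Balaban1985BackgroundPropagators, (3.42) p.397, bookkeeping] -/
theorem eBlock_KSCUPar_iff {B₀ δ : ℝ} (c : (codingYx P G x C37 C38).bg.Cfg) :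
    EBlock (KSCUPar P G x parA parH C37 C38) B₀ δ c ↔ EBlock (KSCU P G x parA C37 C38) B₀ δ c := by
  rw [EBlock, EBlock, (KSCUPar_blind_members P G x parA parH C37 C38).1]

/-- the (3.47) block of `KSCUPar` IS that of `KSCU parA`. [cite: Balaban1985BackgroundPropagators, (3.47) p.398, bookkeeping] -/
theorem globBlock_KSCUPar_iff {B : ℝ} (c : (codingYx P G x C37 C38).bg.Cfg) :
    GlobBlock (KSCUPar P G x parA parH C37 C38) B c ↔ GlobBlock (KSCU P G x parA C37 C38) B c := by
  rw [GlobBlock, GlobBlock, (KSCUPar_blind_members P G x parA parH C37 C38).2.2.2]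

/-- the (3.44) block of `KSCUPar` IS that of `KSCU parA`. [cite: Balaban1985BackgroundPropagators, (3.44) p.398, bookkeeping] -/
theorem e4Block_KSCUPar_iff {Bε : ℝ → ℝ} {δ : ℝ} (c : (codingYx P G x C37 C38).bg.Cfg) :
    E4Block (KSCUPar P G x parA parH C37 C38) Bε δ c ↔ E4Block (KSCU P G x parA C37 C38) Bε δ c := by
  rw [E4Block, E4Block, (KSCUPar_blind_members P G x parA parH C37 C38).2.1]

variable [Fintype (geo9Y x).Site] [FiniteDimensional ℝ 𝔸]

/-- the (3.42) reading dictionary of `KSC₇Par` is `KSC parA`'s. [cite: Balaban1985BackgroundPropagators, (3.42) p.397; Balaban1984PropagatorsII, (2.51) p.232] -/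
theorem read342Y_KSC₇Par (hι : ∀ s : BlkY x.toKIdx, β x.toKIdx.hN x.toKIdx.D x.toKIdx.hk (ιB s) = s)
    (M₂ : ℝ) (hM₂ : 0 ≤ M₂) (hrepr : ∀ (v : 𝔸) (j : ι), |b.repr v j| ≤ M₂ * ‖v‖) (c35 MInv aInv : ℝ) :
    Read342Y P G x parA b ιB C37 C38 (KSC₇Par P G x parA parH C37 C38) c35 (M₂ * ∑ j, ‖b j‖) MInv aInv 0 True :=
  fun α₀ U B₀ δ hM hα₀ hMa hreg hB₀ hδ hE =>
    read342Y_KSC P G x parA b ιB C37 C38 hι M₂ hM₂ hrepr c35 MInv aInv α₀ U B₀ δ hM hα₀ hMa hreg hB₀ hδ ((eBlock_KSC₇Par_iff P G x parA parH C37 C38 _).1 hE)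

omit [FiniteDimensional ℝ 𝔸] in
/-- the (3.42) writing dictionary of `KSC₇Par` is `KSC parA`'s. [cite: Balaban1985BackgroundPropagators, (3.42) p.397, p.403; Balaban1984PropagatorsII, (2.51) p.232] -/
theorem write342Y_KSC₇Par (hι : ∀ s : BlkY x.toKIdx, β x.toKIdx.hN x.toKIdx.D x.toKIdx.hk (ιB s) = s)
    (M₂ : ℝ) (hM₂ : 0 ≤ M₂) (hrepr : ∀ (v : 𝔸) (j : ι), |b.repr v j| ≤ M₂ * ‖v‖) (aW : ℝ) (hC37 : ∀ β' U a, C37 β' U a → GVal G x.toKIdx U) :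
    Write342Y P G x parA b ιB C37 C38 (KSC₇Par P G x parA parH C37 C38) (fun B _ => (M₂ * ∑ j, ‖b j‖) * B + 1) (fun δ => δ) aW 0 True :=
  fun U a α₁ B δ hα₁ hα₁W h37 hB hδ hG hDG hGD hLG =>
    (eBlock_KSC₇Par_iff P G x parA parH C37 C38 _).2 (write342Y_KSC P G x parA b ιB C37 C38 hι M₂ hM₂ hrepr aW hC37 U a α₁ B δ hα₁ hα₁W h37 hB hδ hG hDG hGD hLG)

/-! ## §2 The input transport `KSCUPar ⟹ KSC₇Par` at a regular base -/

omit [FiniteDimensional ℝ 𝔸] in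
/-- ★★ **THE `hin` ESTIMATE AT ONE REGULAR BASE FOR THE TWO-TRANSPORTER READING**: at a `G`-valued `U` (above `2(d+1) < M`, neighbourhood count `mN`) the block
of `(KSCUPar parA parH, KACU, C)` gives that of `(KSC₇Par parA parH, KACU, C)` with `B₀ ↦ c_in(δ₀)·max B₀ 0` and every other constant unchanged: the two cross (3.42)
entries of the augmented family by `eBlock_KSC_base` AT `parA` (the record reading's (3.42) member does not read the transporter), the (3.46)∕(3.47) members and the
whole Hölder block (3.43)–(3.45) BY IDENTITY (the latter at the transporter `parH`, on both sides).
[cite: Balaban1985BackgroundPropagators, Thms 3.1–3.3 (3.42)–(3.48) pp.397–399, (3.3) p.390, (3.8) p.392, (3.40) p.397; Balaban1984PropagatorsII, Lemma 2.1 (2.61) p.234] -/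
theorem thms_KSC₇Par_base_of_KSCUPar (hι : ∀ s : BlkY x.toKIdx, β x.toKIdx.hN x.toKIdx.D x.toKIdx.hk (ιB s) = s)
    (hG1 : ∀ u : 𝔸ˣ, u ∈ G → ‖(u : 𝔸)‖ ≤ 1) {U : CfgY 𝔸 x.toKIdx} (hU : GVal G x.toKIdx U)
    {M₂ : ℝ} (hM₂ : 0 ≤ M₂) (hrepr : ∀ (v : 𝔸) (j : ι), |b.repr v j| ≤ M₂ * ‖v‖) (hM : 2 * ((d : ℝ) + 1) < (geo9Y x).M)
    {mN : ℕ} (hN : ∀ a : IBondY x.toKIdx, (nbr (geo9Y x) (2 * ((d : ℝ) + 1)) a).card ≤ mN)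
    (dC : ℕ) (Cinv : B9.SiteKernel (geo9Y x) (bg9YC 𝔸 G P x)) {B₀ δ₀ : ℝ} {Bβ Bε : ℝ → ℝ} {Bεβ : ℝ → ℝ → ℝ} {B₁ δ₁ : ℝ}
    (h : B9.Thms31to33IneqAt dC (KSCUPar P G x parA parH C37 C38) (KACU P G x OA parB C37 C38) (pullS (codingYx P G x C37 C38) Cinv)
      B₀ δ₀ Bβ Bε Bεβ B₁ δ₁ (.base U)) :
    B9.Thms31to33IneqAt dC (KSC₇Par P G x parA parH C37 C38) (KACU P G x OA parB C37 C38) (pullS (codingYx P G x C37 C38) Cinv)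
      ((((ℓ + 1 : ℕ) : ℝ) * Real.exp (|δ₀| * (2 * ((d : ℝ) + 1))) + ((mN : ℝ) * (M₂ * ∑ j, ‖b j‖) * Real.exp (|δ₀| * (2 * ((d : ℝ) + 1))) + 1))
        * max B₀ 0) δ₀ Bβ Bε Bεβ B₁ δ₁ (.base U) := by
  set cIn : ℝ := ((ℓ + 1 : ℕ) : ℝ) * Real.exp (|δ₀| * (2 * ((d : ℝ) + 1))) + ((mN : ℝ) * (M₂ * ∑ j, ‖b j‖) * Real.exp (|δ₀| * (2 * ((d : ℝ) + 1))) + 1)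
    with hcIn
  have hSb : 0 ≤ ∑ j, ‖b j‖ := Finset.sum_nonneg fun _ _ => norm_nonneg _
  have h1 : 1 ≤ cIn := by
    have h1 : (1 : ℝ) ≤ ((ℓ + 1 : ℕ) : ℝ) := by exact_mod_cast Nat.succ_le_succ (Nat.zero_le ℓ)
    have h2 : (1 : ℝ) ≤ Real.exp (|δ₀| * (2 * ((d : ℝ) + 1))) := Real.one_le_exp (by positivity)
    have h3 : 0 ≤ (mN : ℝ) * (M₂ * ∑ j, ‖b j‖) * Real.exp (|δ₀| * (2 * ((d : ℝ) + 1))) := by positivity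
    rw [hcIn]; nlinarith
  have hB : B₀ ≤ cIn * max B₀ 0 := by
    have hm : B₀ ≤ max B₀ 0 := le_max_left _ _
    have hm0 : 0 ≤ max B₀ 0 := le_max_right _ _
    nlinarith
  -- the blocks at the base; the (3.42)∕(3.46)∕(3.47) part of `KSCUPar parA parH` is `KSCU parA`'s (transporter-blind members), i.e. the pulled-back
  -- record reading's at `(parA, parA)`
  obtain ⟨⟨h42, h43⟩, hC, ⟨g42, g43⟩⟩ := h
  obtain ⟨be, be4, bl2, bglob⟩ := KSCUPar_blind_members P G x parA parH C37 C38
  have h42U : B9.Ineq342_346_347 (KSCU P G x parA C37 C38) B₀ δ₀ (.base U) :=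
    ineq342_346_347_congr P G x C37 C38 _ _ (fun n => congrFun (congrFun be n) _) (fun n => congrFun (congrFun bl2 n) _)
      (fun n => congrFun (congrFun bglob n) _) B₀ δ₀ h42
  obtain ⟨ue, -, -, -, ul2, uglob⟩ := B9SectBStepsKSCUR.KSCU_members_base P G x parA C37 C38 U
  have h42P : B9.Ineq342_346_347 (pullK (codingYx P G x C37 C38) (kernelFamilyS x.toKIdx (bg9YC 𝔸 G P x) (fun U => U) (GpY x.toKIdx parA) parA))
      B₀ δ₀ (.base U) :=
    ineq342_346_347_congr P G x C37 C38 _ _ ue ul2 uglob B₀ δ₀ h42U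
  have h42P' := ineq342_346_347_mono P G x C37 C38 _ hB h42P
  -- the member identities at the base
  have mK := KSC_members_base P G x parA C37 C38 U
  have mP := pullK_members_base P G x C37 C38 (kernelFamilyS x.toKIdx (bg9YC 𝔸 G P x) (fun U => U) (GpY x.toKIdx parA) parA) U
  obtain ⟨-, ph1, pe4, ph2, -, -⟩ := KSC₇Par_members P G x parA parH C37 C38
  refine ⟨⟨⟨?_, ?_, ?_⟩, ?_⟩, hC, ⟨ineq342_346_347_mono P G x C37 C38 _ hB g42, g43⟩⟩
  · -- the (3.42) block: g7's conversion for `KSC parA`, from the record reading's (3.42) member (transporter-blind)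
    exact eBlock_KSC_base P G x parA b ιB C37 C38 hι hG1 hU (B9SectBGpTransferInYR.eBlock_of_pullK_base P G x parA C37 C38 h42P.1) hM₂ hrepr hM hN
  · -- (3.46): the same members
    intro n lam hh y y' hc hs
    have e1 := congrFun (congrFun (mK.2.2.2.1 n) lam) hh
    have e2 := congrFun (congrFun (mP.2.2.2.1 n) lam) hh
    rw [show (KSC₇Par P G x parA parH C37 C38).l2 n (.base U) lam hh = (KSC P G x parA C37 C38).l2 n (.base U) lam hh from rfl, e1, ← e2]
    exact h42P'.2.1 n lam hh y y' hc hs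
  · -- (3.47): the same members
    intro n lam γ h4 h4'
    have e1 := congrFun (congrFun (mK.2.2.2.2 n) lam) γ
    have e2 := congrFun (congrFun (mP.2.2.2.2 n) lam) γ
    rw [show (KSC₇Par P G x parA parH C37 C38).glob n (.base U) lam γ = (KSC P G x parA C37 C38).glob n (.base U) lam γ from rfl, e1, ← e2]
    exact h42P'.2.2 n lam γ h4 h4'
  · -- (3.43)–(3.45): the members of `KSC₇Par` ARE `KSCUPar`'s (Hölder transporter `parH` on both sides)
    exact ineq343_345_congr P G x C37 C38 _ _ (congrFun ph1 _).symm (congrFun pe4 _).symm (congrFun ph2 _).symm Bβ Bε Bεβ δ₀ h43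

end Family

/-! ## §2b The input transport with positive constants, on a subfamily -/

section Hin

variable {J : Type} (f : J → MemberY d ℓ hd hL b₀ b₁ Mstar) [∀ x : MemberY d ℓ hd hL b₀ b₁ Mstar, Fintype (geo9Y x).Site]
  (c35 : ℝ) (G : Subgroup 𝔸ˣ) (parA parH : ∀ j : J, SiteParY 𝔸 (f j).toKIdx) (OA : ∀ j : J, BondOpY 𝔸 (f j).toKIdx)
  (parB : ∀ j : J, BondParY 𝔸 (f j).toKIdx) {ι : Type} [Fintype ι] (b : Module.Basis ι ℝ 𝔸)
  (ιB : ∀ j : J, BlkY (f j).toKIdx → IBondY (f j).toKIdx)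
  (C37 C38 : ∀ j : J, ℝ → CfgY 𝔸 (f j).toKIdx → AfldY 𝔸 (f j).toKIdx → Prop)
  (Cinv : ∀ j : J, B9.SiteKernel (geo9Y (f j)) (bg9YC 𝔸 G P (f j))) [FiniteDimensional ℝ 𝔸]

omit [FiniteDimensional ℝ 𝔸] in
/-- ★★ **`hin` FOR THE TWO-TRANSPORTER READING WITH POSITIVE OUTPUT CONSTANTS** (input families `(KSCUPar parA parH, KACU, pullS Cinv)`; output the frame family
`KSC₇Par parA parH` with the shared `KACU`, `pullS Cinv`): above the M-threshold `max ML (2(d+1)+1)` (the neighbourhood count's), with the vacuous cap `1` and the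
constants `(max (c_in(δ₀)·max B₀ 0) 1, δ₀, B_β, B_ε, B_εβ, B₁, δ₁)`, at every regular coded configuration (a base) §2's estimate.
[cite: Balaban1985BackgroundPropagators, Thms 3.1–3.3 (3.42)–(3.48) pp.397–399, (3.35) p.396, (3.40) p.397; Balaban1984PropagatorsII, (2.51) p.232] -/
theorem hin_KSCUPar_on_pos (hι : ∀ (j : J) (s : BlkY (f j).toKIdx), β (f j).toKIdx.hN (f j).toKIdx.D (f j).toKIdx.hk (ιB j s) = s)
    (hG1 : ∀ u : 𝔸ˣ, u ∈ G → ‖(u : 𝔸)‖ ≤ 1) {M₂ : ℝ} (hM₂ : 0 ≤ M₂) (hrepr : ∀ (v : 𝔸) (j : ι), |b.repr v j| ≤ M₂ * ‖v‖) (dC : ℕ) :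
    ∀ (B₀ δ₀ : ℝ) (Bβ Bε : ℝ → ℝ) (Bεβ : ℝ → ℝ → ℝ) (B₁ δ₁ : ℝ), 0 < B₀ → 0 < δ₀ → 0 < B₁ → 0 < δ₁ →
      ∃ (Mi ai B₀' δ₀' : ℝ) (Bβ' Bε' : ℝ → ℝ) (Bεβ' : ℝ → ℝ → ℝ) (B₁' δ₁' : ℝ), 0 < ai ∧ 0 < B₀' ∧ 0 < δ₀' ∧ 0 < B₁' ∧ 0 < δ₁' ∧
        ∀ j : J, Mi ≤ (geo9Y (f j)).M → ∀ α₀ : ℝ, 0 < α₀ → (geo9Y (f j)).M * α₀ ≤ ai →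
          ∀ c : (codingYx P G (f j) (C37 j) (C38 j)).bg.Cfg, (codingYx P G (f j) (C37 j) (C38 j)).bg.Reg335 c35 α₀ c →
          B9.Thms31to33IneqAt dC (KSCUPar P G (f j) (parA j) (parH j) (C37 j) (C38 j)) (KACU P G (f j) (OA j) (parB j) (C37 j) (C38 j))
              (pullS (codingYx P G (f j) (C37 j) (C38 j)) (Cinv j)) B₀ δ₀ Bβ Bε Bεβ B₁ δ₁ c →
          B9.Thms31to33IneqAt dC (KSC₇Par P G (f j) (parA j) (parH j) (C37 j) (C38 j)) (KACU P G (f j) (OA j) (parB j) (C37 j) (C38 j))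
              (pullS (codingYx P G (f j) (C37 j) (C38 j)) (Cinv j)) B₀' δ₀' Bβ' Bε' Bεβ' B₁' δ₁' c := by
  intro B₀ δ₀ Bβ Bε Bεβ B₁ δ₁ hB₀ hδ₀ hB₁ hδ₁
  obtain ⟨ML, mN, hcnt⟩ := exists_card_nbr_geo9Y_le_of_M (d := d) (ℓ := ℓ) (hd := hd) (hL := hL) (b₀ := b₀) (b₁ := b₁) (2 * ((d : ℝ) + 1))
  set cIn : ℝ := ((ℓ + 1 : ℕ) : ℝ) * Real.exp (|δ₀| * (2 * ((d : ℝ) + 1))) + ((mN : ℝ) * (M₂ * ∑ j, ‖b j‖) * Real.exp (|δ₀| * (2 * ((d : ℝ) + 1))) + 1)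
    with hcIn
  refine ⟨max ML (2 * ((d : ℝ) + 1) + 1), 1, max (cIn * max B₀ 0) 1, δ₀, Bβ, Bε, Bεβ, B₁, δ₁, one_pos, lt_max_of_lt_right one_pos, hδ₀, hB₁, hδ₁,
    fun j hM α₀ _ _ c hreg hT => ?_⟩
  obtain ⟨U, rfl, hU335⟩ := (codingYx P G (f j) (C37 j) (C38 j)).exists_of_bg_Reg335 hreg
  have hU : GVal G (f j).toKIdx U := hU335.1.1
  have hM2 : 2 * ((d : ℝ) + 1) < (geo9Y (f j)).M := by
    have := le_trans (le_max_right _ _) hM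
    linarith
  have hML : ML ≤ (geo9Y (f j)).M := le_trans (le_max_left _ _) hM
  exact thms_mono_B₀ P G (f j) (C37 j) (C38 j) dC _ _ _ (le_max_left _ _)
    (thms_KSC₇Par_base_of_KSCUPar P G (f j) (parA j) (parH j) (OA j) (parB j) b (ιB j) (C37 j) (C38 j) (hι j) hG1 hU hM₂ hrepr hM2
      (fun a => hcnt Mstar (f j) hML a) dC (Cinv j) hT)

/-! ## §3 The output transports for `KSCUPar` ((3.42), (3.47)) -/

/-- ★ **THE (3.42) OUTPUT DOMINATION FOR `KSCUPar`, NO THRESHOLD, SAME RATE** (input `KSC₇Par`'s = `KSC parA`'s block at the product, output `KSCUPar`'s = `KSCU parA`'s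
with `c_R²·B`; `eBlock_KSCU_of_KSC` at `parA`). [cite: Balaban1985BackgroundPropagators, (3.42) p.397, Thm 3.4 p.400, p.403 l.1–9] -/
theorem houtE_KSCUPar_on (hι : ∀ (j : J) (s : BlkY (f j).toKIdx), β (f j).toKIdx.hN (f j).toKIdx.D (f j).toKIdx.hk (ιB j s) = s)
    {M₂ : ℝ} (hM₂ : 0 ≤ M₂) (hrepr : ∀ (v : 𝔸) (j : ι), |b.repr v j| ≤ M₂ * ‖v‖) (hcR : 0 < M₂ * ∑ j, ‖b j‖) :
    ∀ (B δ a : ℝ), 0 < B → 0 < δ → 0 < a →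
      ∃ (Mo ao a' B' δ' : ℝ), 0 < ao ∧ 0 < a' ∧ a' ≤ a ∧ 0 < B' ∧ 0 < δ' ∧
        ∀ j : J, Mo ≤ (geo9Y (f j)).M → ∀ α₀ : ℝ, 0 < α₀ → (geo9Y (f j)).M * α₀ ≤ ao →
          ∀ c : (codingYx P G (f j) (C37 j) (C38 j)).bg.Cfg, (codingYx P G (f j) (C37 j) (C38 j)).bg.Reg335 c35 α₀ c →
          ∀ α₁ : ℝ, 0 < α₁ → α₁ ≤ a' → ∀ c' : (codingYx P G (f j) (C37 j) (C38 j)).bg.Cfg, (codingYx P G (f j) (C37 j) (C38 j)).bg.Cplx337 α₁ c c' →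
          EBlock (KSC₇Par P G (f j) (parA j) (parH j) (C37 j) (C38 j)) B δ ((codingYx P G (f j) (C37 j) (C38 j)).bg.mul c' c) →
          EBlock (KSCUPar P G (f j) (parA j) (parH j) (C37 j) (C38 j)) B' δ' ((codingYx P G (f j) (C37 j) (C38 j)).bg.mul c' c) :=
  fun B δ a hB hδ ha => ⟨0, 1, a, M₂ * (∑ j, ‖b j‖) * (M₂ * (∑ j, ‖b j‖) * B), δ, one_pos, ha, le_rfl, mul_pos hcR (mul_pos hcR hB), hδ,
    fun j _ _ _ _ _ _ _ _ _ _ _ hE => (eBlock_KSCUPar_iff P G (f j) (parA j) (parH j) (C37 j) (C38 j) _).2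
      (eBlock_KSCU_of_KSC P G (f j) (parA j) b (ιB j) (C37 j) (C38 j) (hι j) hM₂ hrepr hB.le
        ((eBlock_KSC₇Par_iff P G (f j) (parA j) (parH j) (C37 j) (C38 j) _).1 hE))⟩

/-- ★ **THE (3.47) OUTPUT RECOVERED FROM THE (3.42) OUTPUT FOR `KSCUPar`** (threshold `Mg(δ)`; constant `max (c_R²·B·Cg) 1`; `globBlock_KSCU_of_eBlock_KSC` at `parA`).
[cite: Balaban1985BackgroundPropagators, (3.47) p.398 + p.398 first remark, Thm 3.4 p.400, p.403 l.1–9; Balaban1984PropagatorsII, Lemma 2.1 p.234] -/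
theorem houtEGlob_KSCUPar_on (hι : ∀ (j : J) (s : BlkY (f j).toKIdx), β (f j).toKIdx.hN (f j).toKIdx.D (f j).toKIdx.hk (ιB j s) = s)
    {M₂ : ℝ} (hM₂ : 0 ≤ M₂) (hrepr : ∀ (v : 𝔸) (j : ι), |b.repr v j| ≤ M₂ * ‖v‖) :
    ∀ (B δ a : ℝ), 0 < B → 0 < δ → 0 < a →
      ∃ (Mo ao a' B' : ℝ), 0 < ao ∧ 0 < a' ∧ a' ≤ a ∧ 0 < B' ∧
        ∀ j : J, Mo ≤ (geo9Y (f j)).M → ∀ α₀ : ℝ, 0 < α₀ → (geo9Y (f j)).M * α₀ ≤ ao →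
          ∀ c : (codingYx P G (f j) (C37 j) (C38 j)).bg.Cfg, (codingYx P G (f j) (C37 j) (C38 j)).bg.Reg335 c35 α₀ c →
          ∀ α₁ : ℝ, 0 < α₁ → α₁ ≤ a' → ∀ c' : (codingYx P G (f j) (C37 j) (C38 j)).bg.Cfg, (codingYx P G (f j) (C37 j) (C38 j)).bg.Cplx337 α₁ c c' →
          EBlock (KSC₇Par P G (f j) (parA j) (parH j) (C37 j) (C38 j)) B δ ((codingYx P G (f j) (C37 j) (C38 j)).bg.mul c' c) →
          GlobBlock (KSCUPar P G (f j) (parA j) (parH j) (C37 j) (C38 j)) B' ((codingYx P G (f j) (C37 j) (C38 j)).bg.mul c' c) := by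
  intro B δ a hB hδ ha
  obtain ⟨Mg, Cg, -, HG⟩ := globBlock_KSCU_of_eBlock_KSC P (d := d) (ℓ := ℓ) (hd := hd) (hL := hL) (b₀ := b₀) (b₁ := b₁) (Mstar := Mstar) G b hδ hM₂ hrepr
  refine ⟨Mg, 1, a, max (M₂ * (∑ j, ‖b j‖) * (M₂ * (∑ j, ‖b j‖) * B) * Cg) 1, one_pos, ha, le_rfl, lt_max_of_lt_right one_pos,
    fun j hM _ _ _ _ _ _ _ _ _ _ hE => ?_⟩
  have hglob := HG (f j) (ιB j) (hι j) hM (parA j) (C37 j) (C38 j) _ B hB.le ((eBlock_KSC₇Par_iff P G (f j) (parA j) (parH j) (C37 j) (C38 j) _).1 hE)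
  rw [globBlock_KSCUPar_iff]
  intro n lam γ hγ₁ hγ₂
  exact (hglob n lam γ hγ₁ hγ₂).trans (mul_le_mul_of_nonneg_right (le_max_left _ _) (geo9K_wNorm_nonneg (f j).toKIdx γ lam))

/-! ## §4 The transporter-blind members of the Sect.-B step for `(KSCUPar, KACU, C⁻¹(parA))` -/

variable [∀ x : MemberY d ℓ hd hL b₀ b₁ Mstar, DecidableEq (geo9Y x).Site] [∀ x : MemberY d ℓ hd hL b₀ b₁ Mstar, Nonempty (geo9Y x).Site] [NormOneClass 𝔸]
  [DecidableEq ι]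

/-- ★ **`StepEPos` OF THE TWO-TRANSPORTER READING over the coded carrier** (input families `(KSCUPar, KACU, pullS C⁻¹)`; output `KSCUPar`'s (3.42) block at the
product): the root-frame step `stepEPos_of_gpFrame₂` AT `KSC₇Par` (dictionaries `read342Y_KSC₇Par ∕ write342Y_KSC₇Par`), transported by `stepEPos_of_family_pos` —
`hin_KSCUPar_on_pos`, `houtE_KSCUPar_on`.  Displayed: the root frame's structural data with the laws `hpar hunit hC37` AT THE AVERAGING TRANSPORTER `parA`; no law of
`parH`. [cite: Balaban1985BackgroundPropagators, Thm 3.1 (3.42) p.397, Thm 3.4 p.400, (3.60)–(3.64) p.402, p.403 l.1–9, (3.35)–(3.37) p.396; Balaban1984PropagatorsII, Lemma 2.1 p.234, (2.51) p.232] -/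
theorem stepEPos_KSCUPar_on (hι : ∀ (j : J) (s : BlkY (f j).toKIdx), β (f j).toKIdx.hN (f j).toKIdx.D (f j).toKIdx.hk (ιB j s) = s)
    (hG1 : ∀ u : 𝔸ˣ, u ∈ G → ‖(u : 𝔸)‖ ≤ 1) (hpar : ∀ j (U : CfgY 𝔸 (f j).toKIdx), GVal G (f j).toKIdx U → ∀ z w, parA j U z w ∈ G)
    (hunit : ∀ j (U : CfgY 𝔸 (f j).toKIdx), GVal G (f j).toKIdx U → IsUnit (deltaPrimeAY (f j).toKIdx (parA j) U))
    (dB : ℕ) (M₂ : ℝ) (hM₂ : 0 ≤ M₂) (hrepr : ∀ (v : 𝔸) (j : ι), |b.repr v j| ≤ M₂ * ‖v‖) (hcR : 0 < M₂ * ∑ j, ‖b j‖)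
    (Cq : ℝ) (hCq : 0 ≤ Cq) (hC37 : ∀ j β' U a, C37 j β' U a → GVal G (f j).toKIdx U ∧ CplxLettersY G (f j) (parA j) (ιB j) Cq β' U a)
    (MInv aInv aW : ℝ) (hMInv : 0 < MInv) (haInv : 0 < aInv) (haW : 0 < aW) :
    StepEPos dB c35 (fun j => geo9Y (f j)) (fun j => (codingYx P G (f j) (C37 j) (C38 j)).bg)
      (fun j => KSCUPar P G (f j) (parA j) (parH j) (C37 j) (C38 j)) (fun j => KACU P G (f j) (OA j) (parB j) (C37 j) (C38 j))
      (fun j => pullS (codingYx P G (f j) (C37 j) (C38 j)) (Cinv j)) (fun j => KSCUPar P G (f j) (parA j) (parH j) (C37 j) (C38 j)) :=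
  stepEPos_of_family_pos dB c35 (fun j => geo9Y (f j)) (fun j => (codingYx P G (f j) (C37 j) (C38 j)).bg)
    (fun j => KSC₇Par P G (f j) (parA j) (parH j) (C37 j) (C38 j)) (fun j => KSCUPar P G (f j) (parA j) (parH j) (C37 j) (C38 j))
    (fun j => KACU P G (f j) (OA j) (parB j) (C37 j) (C38 j)) (fun j => KACU P G (f j) (OA j) (parB j) (C37 j) (C38 j))
    (fun j => pullS (codingYx P G (f j) (C37 j) (C38 j)) (Cinv j))
    (fun j => KSC₇Par P G (f j) (parA j) (parH j) (C37 j) (C38 j)) (fun j => KSCUPar P G (f j) (parA j) (parH j) (C37 j) (C38 j))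
    (hin_KSCUPar_on_pos P f c35 G parA parH OA parB b ιB C37 C38 Cinv hι hG1 hM₂ hrepr dB)
    (houtE_KSCUPar_on P f c35 G parA parH b ιB C37 C38 hι hM₂ hrepr hcR)
    (stepEPos_of_gpFrame₂ (d := dB)
      (gpFrame₂CodedOn P f c35 G b C37 C38 parA ιB (fun j => KSC₇Par P G (f j) (parA j) (parH j) (C37 j) (C38 j)) hι hG1 hpar hunit dB M₂ hM₂ hrepr Cq hCq hC37
        (M₂ * ∑ j, ‖b j‖) hcR (fun B _ => (M₂ * ∑ j, ‖b j‖) * B + 1) (fun B _ hB _ => by positivity) (fun δ => δ) (fun δ hδ => hδ)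
        MInv aInv aW hMInv haInv haW (fun j => read342Y_KSC₇Par P G (f j) (parA j) (parH j) b (ιB j) (C37 j) (C38 j) (hι j) M₂ hM₂ hrepr c35 MInv aInv)
        (fun j => write342Y_KSC₇Par P G (f j) (parA j) (parH j) b (ιB j) (C37 j) (C38 j) (hι j) M₂ hM₂ hrepr aW fun β' U a h => (hC37 j β' U a h).1))
      _ _)

/-- ★ **`StepGlobPos` OF THE TWO-TRANSPORTER READING over the coded carrier** — the (3.47) block at the product recovered from the root-frame (3.42) step AT `KSC₇Par`
(`stepPos_blk_of_family_pos`: `EBlock KSC₇Par ↦ GlobBlock KSCUPar`, `houtEGlob_KSCUPar_on`); laws displayed at `parA` only.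
[cite: Balaban1985BackgroundPropagators, Thm 3.1 (3.47) p.398 + p.398 first remark, Thm 3.4 p.400, p.402, p.403 l.1–9; Balaban1984PropagatorsII, Lemma 2.1 p.234] -/
theorem stepGlobPos_KSCUPar_on (hι : ∀ (j : J) (s : BlkY (f j).toKIdx), β (f j).toKIdx.hN (f j).toKIdx.D (f j).toKIdx.hk (ιB j s) = s)
    (hG1 : ∀ u : 𝔸ˣ, u ∈ G → ‖(u : 𝔸)‖ ≤ 1) (hpar : ∀ j (U : CfgY 𝔸 (f j).toKIdx), GVal G (f j).toKIdx U → ∀ z w, parA j U z w ∈ G)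
    (hunit : ∀ j (U : CfgY 𝔸 (f j).toKIdx), GVal G (f j).toKIdx U → IsUnit (deltaPrimeAY (f j).toKIdx (parA j) U))
    (dB : ℕ) (M₂ : ℝ) (hM₂ : 0 ≤ M₂) (hrepr : ∀ (v : 𝔸) (j : ι), |b.repr v j| ≤ M₂ * ‖v‖) (hcR : 0 < M₂ * ∑ j, ‖b j‖)
    (Cq : ℝ) (hCq : 0 ≤ Cq) (hC37 : ∀ j β' U a, C37 j β' U a → GVal G (f j).toKIdx U ∧ CplxLettersY G (f j) (parA j) (ιB j) Cq β' U a)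
    (MInv aInv aW : ℝ) (hMInv : 0 < MInv) (haInv : 0 < aInv) (haW : 0 < aW) :
    StepGlobPos dB c35 (fun j => geo9Y (f j)) (fun j => (codingYx P G (f j) (C37 j) (C38 j)).bg)
      (fun j => KSCUPar P G (f j) (parA j) (parH j) (C37 j) (C38 j)) (fun j => KACU P G (f j) (OA j) (parB j) (C37 j) (C38 j))
      (fun j => pullS (codingYx P G (f j) (C37 j) (C38 j)) (Cinv j)) (fun j => KSCUPar P G (f j) (parA j) (parH j) (C37 j) (C38 j)) := by
  refine stepPos_blk_of_family_pos dB c35 (fun j => geo9Y (f j)) (fun j => (codingYx P G (f j) (C37 j) (C38 j)).bg)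
    (fun j => KSC₇Par P G (f j) (parA j) (parH j) (C37 j) (C38 j)) (fun j => KSCUPar P G (f j) (parA j) (parH j) (C37 j) (C38 j))
    (fun j => KACU P G (f j) (OA j) (parB j) (C37 j) (C38 j)) (fun j => KACU P G (f j) (OA j) (parB j) (C37 j) (C38 j))
    (fun j => pullS (codingYx P G (f j) (C37 j) (C38 j)) (Cinv j))
    (C₁ := ℝ × ℝ) (C₂ := ℝ) (pos₁ := fun c => 0 < c.1 ∧ 0 < c.2) (pos₂ := fun c => 0 < c)
    (Blk₁ := fun c j W => EBlock (KSC₇Par P G (f j) (parA j) (parH j) (C37 j) (C38 j)) c.1 c.2 W)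
    (Blk₂ := fun c j W => GlobBlock (KSCUPar P G (f j) (parA j) (parH j) (C37 j) (C38 j)) c W)
    (hin_KSCUPar_on_pos P f c35 G parA parH OA parB b ιB C37 C38 Cinv hι hG1 hM₂ hrepr dB) (fun c hc a ha => ?_)
    (stepEPos_of_gpFrame₂ (d := dB)
      (gpFrame₂CodedOn P f c35 G b C37 C38 parA ιB (fun j => KSC₇Par P G (f j) (parA j) (parH j) (C37 j) (C38 j)) hι hG1 hpar hunit dB M₂ hM₂ hrepr Cq hCq hC37
        (M₂ * ∑ j, ‖b j‖) hcR (fun B _ => (M₂ * ∑ j, ‖b j‖) * B + 1) (fun B _ hB _ => by positivity) (fun δ => δ) (fun δ hδ => hδ)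
        MInv aInv aW hMInv haInv haW (fun j => read342Y_KSC₇Par P G (f j) (parA j) (parH j) b (ιB j) (C37 j) (C38 j) (hι j) M₂ hM₂ hrepr c35 MInv aInv)
        (fun j => write342Y_KSC₇Par P G (f j) (parA j) (parH j) b (ιB j) (C37 j) (C38 j) (hι j) M₂ hM₂ hrepr aW fun β' U a h => (hC37 j β' U a h).1))
      _ _)
  obtain ⟨Mo, ao, a', B', hao, ha', ha'a, hB', H⟩ := houtEGlob_KSCUPar_on P f c35 G parA parH b ιB C37 C38 hι hM₂ hrepr c.1 c.2 a hc.1 hc.2 ha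
  exact ⟨Mo, ao, a', B', hao, ha', ha'a, hB', H⟩

/-- ★ **`StepE4Pos` OF THE TWO-TRANSPORTER READING over the coded carrier** (the (3.44) member; input families `(KSCUPar, KACU, pullS C⁻¹)`): the (3.44) frame
`e4Frame₃CodedOn` AT `parA` (family `KSC₆ parA`) RE-KEYED to `KSC₇Par` by `E4Frame₃.swapGp` (same (3.42) and (3.44) blocks — the (3.44) member does not read the
transporter), its step `stepE4Pos_of_e4Frame₃`, transported by `stepE4Pos_of_family_pos` (`hin_KSCUPar_on_pos`, identity output).  Laws displayed at `parA` only.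
[cite: Balaban1985BackgroundPropagators, Thm 3.4 p.400, (3.44) p.398, p.403 l.2–5, (3.60)–(3.65) pp.402–403; Balaban1984PropagatorsII, Lemma 2.1 p.234, (2.51)–(2.52) p.232] -/
theorem stepE4Pos_KSCUPar_on (hι : ∀ (j : J) (s : BlkY (f j).toKIdx), β (f j).toKIdx.hN (f j).toKIdx.D (f j).toKIdx.hk (ιB j s) = s)
    (hG1 : ∀ u : 𝔸ˣ, u ∈ G → ‖(u : 𝔸)‖ ≤ 1) (hpar : ∀ j (U : CfgY 𝔸 (f j).toKIdx), GVal G (f j).toKIdx U → ∀ z w, parA j U z w ∈ G)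
    (hunit : ∀ j (U : CfgY 𝔸 (f j).toKIdx), GVal G (f j).toKIdx U → IsUnit (deltaPrimeAY (f j).toKIdx (parA j) U))
    (dB : ℕ) (M₂ : ℝ) (hM₂ : 0 ≤ M₂) (hrepr : ∀ (v : 𝔸) (j : ι), |b.repr v j| ≤ M₂ * ‖v‖) (hcR : 0 < M₂ * ∑ j, ‖b j‖)
    (Cq : ℝ) (hCq : 0 ≤ Cq) (hC37 : ∀ j β' U a, C37 j β' U a → GVal G (f j).toKIdx U ∧ CplxLettersY G (f j) (parA j) (ιB j) Cq β' U a)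
    (MInv aInv aW : ℝ) (hMInv : 0 < MInv) (haInv : 0 < aInv) (haW : 0 < aW) :
    StepE4Pos dB c35 (fun j => geo9Y (f j)) (fun j => (codingYx P G (f j) (C37 j) (C38 j)).bg)
      (fun j => KSCUPar P G (f j) (parA j) (parH j) (C37 j) (C38 j)) (fun j => KACU P G (f j) (OA j) (parB j) (C37 j) (C38 j))
      (fun j => pullS (codingYx P G (f j) (C37 j) (C38 j)) (Cinv j)) (fun j => KSCUPar P G (f j) (parA j) (parH j) (C37 j) (C38 j)) :=
  stepE4Pos_of_family_pos dB c35 (fun j => geo9Y (f j)) (fun j => (codingYx P G (f j) (C37 j) (C38 j)).bg)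
    (fun j => KSC₇Par P G (f j) (parA j) (parH j) (C37 j) (C38 j)) (fun j => KSCUPar P G (f j) (parA j) (parH j) (C37 j) (C38 j))
    (fun j => KACU P G (f j) (OA j) (parB j) (C37 j) (C38 j)) (fun j => KACU P G (f j) (OA j) (parB j) (C37 j) (C38 j))
    (fun j => pullS (codingYx P G (f j) (C37 j) (C38 j)) (Cinv j))
    (fun j => KSC₇Par P G (f j) (parA j) (parH j) (C37 j) (C38 j)) (fun j => KSCUPar P G (f j) (parA j) (parH j) (C37 j) (C38 j))
    (hin_KSCUPar_on_pos P f c35 G parA parH OA parB b ιB C37 C38 Cinv hι hG1 hM₂ hrepr dB)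
    (fun Bε δ a hδ ha => ⟨0, 1, a, Bε, δ, one_pos, ha, le_rfl, hδ,
      fun j _ _ _ _ _ _ _ _ _ _ _ h => (e4Block_KSC₇Par_iff P G (f j) (parA j) (parH j) (C37 j) (C38 j) _).1 h⟩)
    (stepE4Pos_of_e4Frame₃ (d := dB)
      ((e4Frame₃CodedOn P f c35 G parA b ιB C37 C38 hι hG1 hpar hunit dB M₂ hM₂ hrepr hcR Cq hCq hC37 MInv aInv aW hMInv haInv haW).swapGp
        (fun j => KSC₇Par P G (f j) (parA j) (parH j) (C37 j) (C38 j))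
        (fun j _ _ c => (eBlock_KSC₇Par_iff P G (f j) (parA j) (parH j) (C37 j) (C38 j) c).trans (eBlock_KSC₆_iff P G (f j) (parA j) (C37 j) (C38 j) c).symm)
        (fun j _ _ c => e4Block_KSC₇Par_iff_KSC₆ P G (f j) (parA j) (parH j) (C37 j) (C38 j) c))
      _ _)

/-- ★ **`StepKerPos` OF THE FRAME FAMILY `KSC₇Par` WITH THE RECORD's (3.48) KERNEL OF `C = CY parA (GpY parA)`** (any shared `GA`): `stepKerPos_of_cinvFrame₃` on
the (G′, C⁻¹) frame `cinvFrame₃CodedOn` AT `parA` RE-KEYED to `KSC₇Par` by `CinvFrame₃.swapGp`.  Displayed: the root frame's data, `hunitX`, `hsym` — all at `parA`.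
[cite: Balaban1985BackgroundPropagators, Thm 3.4 p.400, Thm 3.2 (3.48) p.398, (3.65)–(3.67) p.403, (3.57)–(3.59) pp.401–402; Balaban1984PropagatorsII, Lemma 2.1 p.234, (2.51) p.232] -/
theorem stepKerPos_KSC₇Par_cinv_on (hι : ∀ (j : J) (s : BlkY (f j).toKIdx), β (f j).toKIdx.hN (f j).toKIdx.D (f j).toKIdx.hk (ιB j s) = s)
    (hG1 : ∀ u : 𝔸ˣ, u ∈ G → ‖(u : 𝔸)‖ ≤ 1) (hpar : ∀ j (U : CfgY 𝔸 (f j).toKIdx), GVal G (f j).toKIdx U → ∀ z w, parA j U z w ∈ G)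
    (hunit : ∀ j (U : CfgY 𝔸 (f j).toKIdx), GVal G (f j).toKIdx U → IsUnit (deltaPrimeAY (f j).toKIdx (parA j) U))
    (M₂ : ℝ) (hM₂ : 0 ≤ M₂) (hrepr : ∀ (v : 𝔸) (j : ι), |b.repr v j| ≤ M₂ * ‖v‖) (hcR : 0 < M₂ * ∑ j, ‖b j‖)
    (Cq : ℝ) (hCq : 0 ≤ Cq) (hC37 : ∀ j β' U a, C37 j β' U a → GVal G (f j).toKIdx U ∧ CplxLettersY G (f j) (parA j) (ιB j) Cq β' U a)
    (MInv aInv aW : ℝ) (hMInv : 0 < MInv) (haInv : 0 < aInv) (haW : 0 < aW)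
    (hunitX : ∀ j (U : CfgY 𝔸 (f j).toKIdx), GVal G (f j).toKIdx U → IsUnit (XY (f j).toKIdx (parA j) (GpY (f j).toKIdx (parA j)) U))
    (hsym : ∀ j (U : CfgY 𝔸 (f j).toKIdx) (z w : SiteY (f j).toKIdx), parA j U z w = (parA j U w z)⁻¹)
    (GA : ∀ j : J, B9.KernelFamily (geo9Y (f j)) (codingYx P G (f j) (C37 j) (C38 j)).bg) :
    StepKerPos (d + 1) c35 (fun j => geo9Y (f j)) (fun j => (codingYx P G (f j) (C37 j) (C38 j)).bg) (fun j => KSC₇Par P G (f j) (parA j) (parH j) (C37 j) (C38 j)) GA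
      (fun j => pullS (codingYx P G (f j) (C37 j) (C38 j)) (CinvY P f G parA j)) (fun j => pullS (codingYx P G (f j) (C37 j) (C38 j)) (CinvY P f G parA j)) :=
  stepKerPos_of_cinvFrame₃ _ _ _ _ _ _ _ _
    ((cinvFrame₃CodedOn P f c35 G parA b ιB C37 C38 hι hG1 hpar hunit M₂ hM₂ hrepr hcR Cq hCq hC37 MInv aInv aW hMInv haInv haW hunitX hsym).swapGp
      (fun j => KSC₇Par P G (f j) (parA j) (parH j) (C37 j) (C38 j)) (fun j _ _ c => eBlock_KSC₇Par_iff P G (f j) (parA j) (parH j) (C37 j) (C38 j) c)) GA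

/-- ★ **`StepKerPos` OF `(KSCUPar, KACU, C⁻¹(parA))` over the coded carriers — the (3.48) member** (the record's kernel of `C = CY parA (GpY parA)` read along the
decoding, shared input∕output): the (G′, C⁻¹) frame `cinvFrame₃CodedOn` AT `parA` RE-KEYED to `KSC₇Par` by `CinvFrame₃.swapGp`, its step `stepKerPos_of_cinvFrame₃`,
transported by `stepKerPos_of_family_pos` (`hin_KSCUPar_on_pos`; identity output).  Displayed beyond the root frame's data: `hunitX` (`(Q′G′²Q′*)(U)` a unit) and the
reversal law `hsym`, BOTH AT THE AVERAGING TRANSPORTER `parA`; no law of `parH`.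
[cite: Balaban1985BackgroundPropagators, Thm 3.4 p.400, Thm 3.2 (3.48) p.398, (3.65)–(3.67) p.403, (3.57)–(3.59) pp.401–402, (3.21) p.394; Balaban1984PropagatorsII, Lemma 2.1 p.234, (2.51) p.232] -/
theorem stepKerPos_KSCUPar_on (hι : ∀ (j : J) (s : BlkY (f j).toKIdx), β (f j).toKIdx.hN (f j).toKIdx.D (f j).toKIdx.hk (ιB j s) = s)
    (hG1 : ∀ u : 𝔸ˣ, u ∈ G → ‖(u : 𝔸)‖ ≤ 1) (hpar : ∀ j (U : CfgY 𝔸 (f j).toKIdx), GVal G (f j).toKIdx U → ∀ z w, parA j U z w ∈ G)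
    (hunit : ∀ j (U : CfgY 𝔸 (f j).toKIdx), GVal G (f j).toKIdx U → IsUnit (deltaPrimeAY (f j).toKIdx (parA j) U))
    (M₂ : ℝ) (hM₂ : 0 ≤ M₂) (hrepr : ∀ (v : 𝔸) (j : ι), |b.repr v j| ≤ M₂ * ‖v‖) (hcR : 0 < M₂ * ∑ j, ‖b j‖)
    (Cq : ℝ) (hCq : 0 ≤ Cq) (hC37 : ∀ j β' U a, C37 j β' U a → GVal G (f j).toKIdx U ∧ CplxLettersY G (f j) (parA j) (ιB j) Cq β' U a)
    (MInv aInv aW : ℝ) (hMInv : 0 < MInv) (haInv : 0 < aInv) (haW : 0 < aW)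
    (hunitX : ∀ j (U : CfgY 𝔸 (f j).toKIdx), GVal G (f j).toKIdx U → IsUnit (XY (f j).toKIdx (parA j) (GpY (f j).toKIdx (parA j)) U))
    (hsym : ∀ j (U : CfgY 𝔸 (f j).toKIdx) (z w : SiteY (f j).toKIdx), parA j U z w = (parA j U w z)⁻¹) :
    StepKerPos (d + 1) c35 (fun j => geo9Y (f j)) (fun j => (codingYx P G (f j) (C37 j) (C38 j)).bg)
      (fun j => KSCUPar P G (f j) (parA j) (parH j) (C37 j) (C38 j)) (fun j => KACU P G (f j) (OA j) (parB j) (C37 j) (C38 j))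
      (fun j => pullS (codingYx P G (f j) (C37 j) (C38 j)) (CinvY P f G parA j)) (fun j => pullS (codingYx P G (f j) (C37 j) (C38 j)) (CinvY P f G parA j)) :=
  stepKerPos_of_family_pos (d + 1) c35 (fun j => geo9Y (f j)) (fun j => (codingYx P G (f j) (C37 j) (C38 j)).bg)
    (fun j => KSC₇Par P G (f j) (parA j) (parH j) (C37 j) (C38 j)) (fun j => KSCUPar P G (f j) (parA j) (parH j) (C37 j) (C38 j))
    (fun j => KACU P G (f j) (OA j) (parB j) (C37 j) (C38 j)) (fun j => KACU P G (f j) (OA j) (parB j) (C37 j) (C38 j))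
    (fun j => pullS (codingYx P G (f j) (C37 j) (C38 j)) (CinvY P f G parA j))
    (hin_KSCUPar_on_pos P f c35 G parA parH OA parB b ιB C37 C38 (CinvY P f G parA) hι hG1 hM₂ hrepr (d + 1))
    (fun j => pullS (codingYx P G (f j) (C37 j) (C38 j)) (CinvY P f G parA j)) (fun j => pullS (codingYx P G (f j) (C37 j) (C38 j)) (CinvY P f G parA j))
    (fun B δ a hB hδ ha => ⟨0, 1, a, B, δ, one_pos, ha, le_rfl, hB, hδ, fun _ _ _ _ _ _ _ _ _ _ _ _ hK => hK⟩)
    (stepKerPos_KSC₇Par_cinv_on P f c35 G parA parH b ιB C37 C38 hι hG1 hpar hunit M₂ hM₂ hrepr hcR Cq hCq hC37 MInv aInv aW hMInv haInv haW hunitX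
      hsym _)

/-- ★ **`StepAnalyticPos1` OF THE TWO-TRANSPORTER READING at the coded pin `IsAnKY parA`** (input families `(KSCUPar, KACU, pullS Cinv)`): the analytic-extension
frame `anFrame₂CodedOn` AT `KSC₇Par`, its step `stepAnalyticPos1_of_anFrame₂`, transported by `stepPos_of_family_pos` (`hin_KSCUPar_on_pos`; the pin does not read the
family).  Laws displayed at `parA` only. [cite: Balaban1985BackgroundPropagators, Thm 3.4 p.400, (3.60)–(3.64) p.402, (3.35)–(3.37) p.396; Balaban1984PropagatorsII, Lemma 2.1 p.234] -/
theorem stepAnalyticPos1_KSCUPar_on (hι : ∀ (j : J) (s : BlkY (f j).toKIdx), β (f j).toKIdx.hN (f j).toKIdx.D (f j).toKIdx.hk (ιB j s) = s)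
    (hG1 : ∀ u : 𝔸ˣ, u ∈ G → ‖(u : 𝔸)‖ ≤ 1) (hpar : ∀ j (U : CfgY 𝔸 (f j).toKIdx), GVal G (f j).toKIdx U → ∀ z w, parA j U z w ∈ G)
    (hunit : ∀ j (U : CfgY 𝔸 (f j).toKIdx), GVal G (f j).toKIdx U → IsUnit (deltaPrimeAY (f j).toKIdx (parA j) U))
    (dB : ℕ) (M₂ : ℝ) (hM₂ : 0 ≤ M₂) (hrepr : ∀ (v : 𝔸) (j : ι), |b.repr v j| ≤ M₂ * ‖v‖) (hcR : 0 < M₂ * ∑ j, ‖b j‖)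
    (Cq : ℝ) (hCq : 0 ≤ Cq) (hC37 : ∀ j β' U a, C37 j β' U a → GVal G (f j).toKIdx U ∧ CplxLettersY G (f j) (parA j) (ιB j) Cq β' U a)
    (MInv aInv aW : ℝ) (hMInv : 0 < MInv) (haInv : 0 < aInv) (haW : 0 < aW) :
    StepAnalyticPos1 dB c35 (fun j => geo9Y (f j)) (fun j => (codingYx P G (f j) (C37 j) (C38 j)).bg)
      (fun j => KSCUPar P G (f j) (parA j) (parH j) (C37 j) (C38 j)) (fun j => KACU P G (f j) (OA j) (parB j) (C37 j) (C38 j))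
      (fun j => pullS (codingYx P G (f j) (C37 j) (C38 j)) (Cinv j))
      (fun j => IsAnKY P G (f j) (parA j) b (C37 j) (C38 j)) (fun j => KSCUPar P G (f j) (parA j) (parH j) (C37 j) (C38 j)) := by
  refine stepPos_of_family_pos dB c35 (fun j => geo9Y (f j)) (fun j => (codingYx P G (f j) (C37 j) (C38 j)).bg)
    (fun j => KSC₇Par P G (f j) (parA j) (parH j) (C37 j) (C38 j)) (fun j => KSCUPar P G (f j) (parA j) (parH j) (C37 j) (C38 j))
    (fun j => KACU P G (f j) (OA j) (parB j) (C37 j) (C38 j)) (fun j => KACU P G (f j) (OA j) (parB j) (C37 j) (C38 j))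
    (fun j => pullS (codingYx P G (f j) (C37 j) (C38 j)) (Cinv j))
    (C₁ := PUnit) (C₂ := PUnit) (pos₁ := fun _ => True) (pos₂ := fun _ => True)
    (Out₁ := fun _ j V α => IsAnKY P G (f j) (parA j) b (C37 j) (C38 j) (KSC₇Par P G (f j) (parA j) (parH j) (C37 j) (C38 j)) V α)
    (Out₂ := fun _ j V α => IsAnKY P G (f j) (parA j) b (C37 j) (C38 j) (KSCUPar P G (f j) (parA j) (parH j) (C37 j) (C38 j)) V α)
    (hin_KSCUPar_on_pos P f c35 G parA parH OA parB b ιB C37 C38 Cinv hι hG1 hM₂ hrepr dB)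
    (fun c hc a ha => ⟨0, 1, a, c, one_pos, ha, le_rfl, hc, fun _ _ _ _ _ _ _ _ _ _ h => h⟩)
    (stepAnalyticPos1_of_anFrame₂ (d := dB)
      (anFrame₂CodedOn P f c35 G b C37 C38 parA ιB (fun j => KSC₇Par P G (f j) (parA j) (parH j) (C37 j) (C38 j)) hι hG1 hpar hunit dB M₂ hM₂ hrepr Cq hCq hC37
        (M₂ * ∑ j, ‖b j‖) hcR (fun B _ => (M₂ * ∑ j, ‖b j‖) * B + 1) (fun B _ hB _ => by positivity) (fun δ => δ) (fun δ hδ => hδ)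
        MInv aInv aW hMInv haInv haW (fun j => read342Y_KSC₇Par P G (f j) (parA j) (parH j) b (ιB j) (C37 j) (C38 j) (hι j) M₂ hM₂ hrepr c35 MInv aInv)
        (fun j => write342Y_KSC₇Par P G (f j) (parA j) (parH j) b (ιB j) (C37 j) (C38 j) (hι j) M₂ hM₂ hrepr aW fun β' U a h => (hC37 j β' U a h).1))
      _ _)

/-- ★ **`StepAnalyticPos` (both halves) OF `(KSCUPar, KACU, C⁻¹)` at `IsAnKY parA`** — the pin ignores the family, so the `KACU` half is the `KSCUPar` half.
[cite: Balaban1985BackgroundPropagators, Thm 3.4 p.400, (3.62)–(3.64) p.402, (3.86) p.407] -/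
theorem stepAnalyticPos_KSCUPar_on (hι : ∀ (j : J) (s : BlkY (f j).toKIdx), β (f j).toKIdx.hN (f j).toKIdx.D (f j).toKIdx.hk (ιB j s) = s)
    (hG1 : ∀ u : 𝔸ˣ, u ∈ G → ‖(u : 𝔸)‖ ≤ 1) (hpar : ∀ j (U : CfgY 𝔸 (f j).toKIdx), GVal G (f j).toKIdx U → ∀ z w, parA j U z w ∈ G)
    (hunit : ∀ j (U : CfgY 𝔸 (f j).toKIdx), GVal G (f j).toKIdx U → IsUnit (deltaPrimeAY (f j).toKIdx (parA j) U))
    (dB : ℕ) (M₂ : ℝ) (hM₂ : 0 ≤ M₂) (hrepr : ∀ (v : 𝔸) (j : ι), |b.repr v j| ≤ M₂ * ‖v‖) (hcR : 0 < M₂ * ∑ j, ‖b j‖)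
    (Cq : ℝ) (hCq : 0 ≤ Cq) (hC37 : ∀ j β' U a, C37 j β' U a → GVal G (f j).toKIdx U ∧ CplxLettersY G (f j) (parA j) (ιB j) Cq β' U a)
    (MInv aInv aW : ℝ) (hMInv : 0 < MInv) (haInv : 0 < aInv) (haW : 0 < aW) :
    StepAnalyticPos dB c35 (fun j => geo9Y (f j)) (fun j => (codingYx P G (f j) (C37 j) (C38 j)).bg)
      (fun j => KSCUPar P G (f j) (parA j) (parH j) (C37 j) (C38 j)) (fun j => KACU P G (f j) (OA j) (parB j) (C37 j) (C38 j))
      (fun j => pullS (codingYx P G (f j) (C37 j) (C38 j)) (Cinv j))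
      (fun j => IsAnKY P G (f j) (parA j) b (C37 j) (C38 j)) := by
  have h := stepAnalyticPos1_KSCUPar_on P f c35 G parA parH OA parB b ιB C37 C38 Cinv hι hG1 hpar hunit dB M₂ hM₂ hrepr hcR Cq hCq hC37 MInv aInv aW
    hMInv haInv haW
  exact stepAnalyticPos_of_halves h h

end Hin

end Literature.MathematicalPhysics.QuantumFieldTheory.Balaban1983to89.B9SectBCodedFamiliesUParH

end
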